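import Summits.RiemannHypothesis.RiemannHypothesis.Theorems.PlantedScrewBlindnessSharp

/-!
# W-06 cycle 7 «DETECTION COST ATLAS», cell C3⁷ — LEVELS WRAPPER (rh-idea-3 g16) — LANE item (6a) = §L of the pre-cut (6)

(CA117)/(CA137) lane slot (6a): the level-wise screw blindness law of C3⁷ RE-POINTED by ONE import onto the landed lane items
(1) `Theorems/PlantedPair.lean` (defs of record `RhIdea2G21.W06C6.pairDefect / plantedScrew / plantedScrewMatrix`),
(2) `Theorems/PlantedScrewBlindness.lean` and (3) `Theorems/PlantedScrewBlindnessSharp.lean` (namespace `RhIdea6.G15.C47`).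
NO screw function is defined here (no `quadScrew` copy).  Body = §L of
`pub/ideators/rh-idea-3/g16/c7/PlantedScrewBlindnessLevels-rh-idea-3-g16.lean` VERBATIM.  The desk pre-cut of record
`PlantedScrewBlindnessLevels.lean` 18002c2d244b21a8 · 445 (§L + §R in ONE file) exceeds the 400-line lint for Theorems files
with proofs; this RE-CUT (CA137) splits it at the §L/§R boundary, bodies byte-verbatim: (6a) = THIS file (§L), (6b) =
`Theorems/PlantedScrewResonance.lean` (§R, INDEPENDENT of §L — it imports `Theorems/PlantedScrewBlindness.lean` directly).
§L: closed-form level law `6·n·((n+1)^δ + 3) < μ_N·(δ² + γ²) ⟹ S_{n+1}(planted) ≻ 0` on the banks N = 512/256/128, the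
three-bank disjunction (= the instrument's certified-blind floor), the height form, and the `ScrewSeesPairBy`-shape negation.
Tier K (kernel, 0 sorry).  Credit rh-idea-3 g16.  READING (TEST 0): the planted object is NOT `ζ`; nothing here bears on the
truth of RH.
-/

noncomputable section

/-!
## §L  LEVELS WRAPPER (rh-idea-3 g16, W-06 cycle 7 cell C3⁷, (CA117) item (6)) — the ONLY new content of this file

Everything ABOVE this section is rh-idea-6 g15's `PlantedScrewBlind-rh-idea-6-g15-rev2.lean` (sha16 cf841c9802ce9c85)
VERBATIM (its §0 = rh-idea-2's defs of record `RhIdea2G21.W06C6.pairDefect / plantedScrew / plantedScrewMatrix`,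
Sketch-C2c6-v2 bbf764651e6c1e8c l.23–35).  AT LANDING the lane deletes lines 1 … (end of `RhIdea6.G15.C47`) and
replaces them by `import …Theorems.PlantedPair` + `import …Theorems.PlantedScrewBlindnessSharp` (lane items (1)–(3));
nothing below defines a screw function (NO `quadScrew` copy): the C3⁷ level law `blindBelowScrew` of rh-idea-3 g15
(Sketch v5 65ab4bc8b9924666, over its own `quadScrew γ δ`) is RE-POINTED here at the defs of record and CLOSED-FORM:

* `posDef_of_level`      — bank 512:  `n ≤ 511 ∧ 6·n·((n+1)^δ + 3) < μ₅₁₂·(δ² + γ²) ⟹ S_{n+1}(planted δ, γ) ≻ 0`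
* `posDef_of_level_256 / _128` — the sharper lower banks (`μ₂₅₆`, `μ₁₂₈`);
* `posDef_of_levelBanks` — the three banks in ONE statement = the instrument's certified-blind floor `M_blind^K♯(γ, δ)`
  (PREREG-W06-7 §2.4 (K) with the sharp constant `6((n+1)^δ+3)` in place of `12((n+1)^δ+1)`);
* `posDef_of_height_level` — height form: `γ² > 6·n·((n+1)^δ + 3)/μ₅₁₂ − δ² ⟹ ≻ 0` (the level-wise `b_S♯(n, δ)`);
* §R (OPTIONAL, independent): the exact rank-4 cosh–sinh form of the defect (`defectCoshSinhForm_holds`) and the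
  resonance-route blind laws `posDef_of_oneScalar / blind_of_sinhSum / blind_of_heightClosedForm` (all K, 0 sorry).

Tier K (kernel, 0 sorry).  Index = level `n + 1 = M`.  Nothing here bears on the truth of RH; `S_512(ζ) ≻ 0` is the
tree's certified computation (`IntegerScrew.screwMatrix_quadForm_ge_511/255/127`).
-/

namespace RhIdea3.G16.Levels

open Literature.NumberTheory.LFunctions
open RhIdea2G21.W06C6
open RhIdea6.G15.C47
open Summit.RiemannHypothesis.RiemannHypothesis.Theorems.IntegerScrew

/-- `e^{δ·log(n+1)} = (n+1)^δ` (real power). -/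
theorem exp_mul_log_eq_rpow (δ : ℝ) (n : ℕ) :
    Real.exp (δ * Real.log ((n : ℝ) + 1)) = ((n : ℝ) + 1) ^ δ := by
  rw [Real.rpow_def_of_pos (by positivity), mul_comm]

/-- the closed-form level inequality implies rev2's hypothesis form (any margin `μ`). -/
theorem level_hyp_of_closedForm {n : ℕ} {δ γ μ : ℝ} (hγ : γ ≠ 0)
    (h : 6 * (n : ℝ) * (((n : ℝ) + 1) ^ δ + 3) < μ * (δ ^ 2 + γ ^ 2)) :
    (n : ℝ) * (6 * ((Real.exp (δ * Real.log ((n : ℝ) + 1)) + 3) / (δ ^ 2 + γ ^ 2))) < μ := by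
  have hd : 0 < δ ^ 2 + γ ^ 2 := by positivity
  rw [exp_mul_log_eq_rpow]
  have : (n : ℝ) * (6 * ((((n : ℝ) + 1) ^ δ + 3) / (δ ^ 2 + γ ^ 2)))
      = (6 * (n : ℝ) * (((n : ℝ) + 1) ^ δ + 3)) / (δ ^ 2 + γ ^ 2) := by ring
  rw [this, div_lt_iff₀ hd]
  exact h

/-- **LEVEL LAW, bank 512 (closed form).** For `n ≤ 511`, `0 ≤ δ`, `γ ≠ 0`:
`6·n·((n+1)^δ + 3) < μ₅₁₂·(δ² + γ²)`, `μ₅₁₂ = 154108636812/2^49`, gives `S_{n+1}(planted δ, γ) ≻ 0`. -/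
theorem posDef_of_level {n : ℕ} {δ γ : ℝ} (hn : n ≤ 511) (hδ : 0 ≤ δ) (hγ : γ ≠ 0)
    (h : 6 * (n : ℝ) * (((n : ℝ) + 1) ^ δ + 3) < (154108636812 : ℝ) / 2 ^ 49 * (δ ^ 2 + γ ^ 2)) :
    (plantedScrewMatrix δ γ n).PosDef :=
  plantedScrewMatrix_posDef_of_bound_511_sharp hn hδ hγ (level_hyp_of_closedForm hγ h)

/-- **LEVEL LAW, bank 256** (`μ₂₅₆ = 486953506312/2^49`, `n ≤ 255`). -/
theorem posDef_of_level_256 {n : ℕ} {δ γ : ℝ} (hn : n ≤ 255) (hδ : 0 ≤ δ) (hγ : γ ≠ 0)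
    (h : 6 * (n : ℝ) * (((n : ℝ) + 1) ^ δ + 3) < (486953506312 : ℝ) / 2 ^ 49 * (δ ^ 2 + γ ^ 2)) :
    (plantedScrewMatrix δ γ n).PosDef :=
  plantedScrewMatrix_posDef_of_margin_sharp hn screwMatrix_quadForm_ge_255 hδ hγ (level_hyp_of_closedForm hγ h)

/-- **LEVEL LAW, bank 128** (`μ₁₂₈ = 1047359042446/2^49`, `n ≤ 127`). -/
theorem posDef_of_level_128 {n : ℕ} {δ γ : ℝ} (hn : n ≤ 127) (hδ : 0 ≤ δ) (hγ : γ ≠ 0)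
    (h : 6 * (n : ℝ) * (((n : ℝ) + 1) ^ δ + 3) < (1047359042446 : ℝ) / 2 ^ 49 * (δ ^ 2 + γ ^ 2)) :
    (plantedScrewMatrix δ γ n).PosDef :=
  plantedScrewMatrix_posDef_of_margin_sharp hn screwMatrix_quadForm_ge_127 hδ hγ (level_hyp_of_closedForm hγ h)

/-- **THE THREE BANKS IN ONE STATEMENT** = the instrument's certified-blind floor with sharp constants:
`S_{n+1}(planted δ, γ) ≻ 0` as soon as ONE bank `B ∈ {128, 256, 512}` with `n + 1 ≤ B` satisfies
`6·n·((n+1)^δ + 3) < μ_B·(δ² + γ²)`. -/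
theorem posDef_of_levelBanks {n : ℕ} {δ γ : ℝ} (hδ : 0 ≤ δ) (hγ : γ ≠ 0)
    (h : (n ≤ 127 ∧ 6 * (n : ℝ) * (((n : ℝ) + 1) ^ δ + 3) < (1047359042446 : ℝ) / 2 ^ 49 * (δ ^ 2 + γ ^ 2)) ∨
         (n ≤ 255 ∧ 6 * (n : ℝ) * (((n : ℝ) + 1) ^ δ + 3) < (486953506312 : ℝ) / 2 ^ 49 * (δ ^ 2 + γ ^ 2)) ∨
         (n ≤ 511 ∧ 6 * (n : ℝ) * (((n : ℝ) + 1) ^ δ + 3) < (154108636812 : ℝ) / 2 ^ 49 * (δ ^ 2 + γ ^ 2))) :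
    (plantedScrewMatrix δ γ n).PosDef := by
  rcases h with ⟨hn, h⟩ | ⟨hn, h⟩ | ⟨hn, h⟩
  · exact posDef_of_level_128 hn hδ hγ h
  · exact posDef_of_level_256 hn hδ hγ h
  · exact posDef_of_level hn hδ hγ h

/-- **HEIGHT FORM of the level law** (`b_S♯(n, δ)² = 6·n·((n+1)^δ + 3)/μ₅₁₂ − δ²`): for `n ≤ 511`, `0 ≤ δ`, `0 < γ`,
`γ² > 6·n·((n+1)^δ + 3)/μ₅₁₂ − δ²` gives `S_{n+1}(planted δ, γ) ≻ 0`. -/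
theorem posDef_of_height_level {n : ℕ} {δ γ : ℝ} (hn : n ≤ 511) (hδ : 0 ≤ δ) (hγ : 0 < γ)
    (h : 6 * (n : ℝ) * (((n : ℝ) + 1) ^ δ + 3) / ((154108636812 : ℝ) / 2 ^ 49) - δ ^ 2 < γ ^ 2) :
    (plantedScrewMatrix δ γ n).PosDef := by
  refine posDef_of_level hn hδ hγ.ne' ?_
  have hμ : (0 : ℝ) < (154108636812 : ℝ) / 2 ^ 49 := by positivity
  have h' : 6 * (n : ℝ) * (((n : ℝ) + 1) ^ δ + 3) / ((154108636812 : ℝ) / 2 ^ 49) < δ ^ 2 + γ ^ 2 := by linarith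
  rw [div_lt_iff₀ hμ] at h'
  have hc : (δ ^ 2 + γ ^ 2) * ((154108636812 : ℝ) / 2 ^ 49) = (154108636812 : ℝ) / 2 ^ 49 * (δ ^ 2 + γ ^ 2) := by
    ring
  have hc' : (((n : ℝ) + 1) ^ δ + 3) * (6 * (n : ℝ)) = 6 * (n : ℝ) * (((n : ℝ) + 1) ^ δ + 3) := by ring
  linarith [h', hc, hc']

/-- «SCREW does not see the pair by order `M`» in rh-idea-2's words (`ScrewSeesPairBy`-shape, all `M' ≤ M`):
if EVERY level `n + 1 ≤ M ≤ 512` passes the closed-form bank-512 test, no `S_{n+1}(planted)`, `n + 1 ≤ M`, fails PSD. -/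
theorem not_sees_by_of_levels {δ γ : ℝ} (hδ : 0 ≤ δ) (hγ : γ ≠ 0) {M : ℕ} (hM : M ≤ 512)
    (h : ∀ n : ℕ, n + 1 ≤ M → 6 * (n : ℝ) * (((n : ℝ) + 1) ^ δ + 3) < (154108636812 : ℝ) / 2 ^ 49 * (δ ^ 2 + γ ^ 2)) :
    ¬ ∃ n : ℕ, n + 1 ≤ M ∧ ¬ (plantedScrewMatrix δ γ n).PosSemidef := by
  rintro ⟨n, hnM, hnot⟩
  exact hnot (posDef_of_level (by omega) hδ hγ (h n hnM)).posSemidef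

end RhIdea3.G16.Levels

end
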